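import Mathlib.Logic.Equiv.Fintype
import Mathlib.Tactic.Module
import Literature.Computability.AlgebraicComplexity.GradedPencilCount
import Literature.Computability.AlgebraicComplexity.LRCanonicalWeights
import HarnessLib

/-!
# Landsberg–Ressayre, Thm. 2.8 — the top weight, the chain, and the count (LR17 §6)

Topic `Literature/Computability/AlgebraicComplexity`.  Concludes the abstract part of the
bottom-up proof of `lr_left_equivariant_lower` (LR17 Thm. 2.8) begun in
`LRCanonicalSubspaces.lean`, `LRTorusWeights.lean` and `LRCanonicalWeights.lean`.  For a torus datum `D` (pencil
`Λ + Σ x_{kj} A_{kj}`, one lift of a generic torus element) we prove, following the last page of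
LR17 §6 but with the canonical subspaces `𝒫_S` in place of the `L'`-modules `ℍ_i`:

* `exists_top`: if `ker Λ` is a line then `range Λ` is a `B`-stable hyperplane and all weight
  spaces `E β` but one (`β = β_top`, the weight of `ℓ_2 = ℂⁿ/range Λ`) lie in `range Λ`;
* escape and symmetry (`supp_eq_univ_of_escape`): the exponent `u_top` with `wt u_top = β_top`
  reached by `𝒫_{[m]}` has FULL support — this replaces LR's character computation
  `χ_{ℓ_2} = α(ε_1 + ⋯ + ε_m)`, `ℓ(χ_{ℍ_k}) ≥ m - 1` (only the lifts of transpositions are used);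
* the chain (`exists_good_of_le_card`): descending from `u_top` one row at a time produces, for
  every `1 ≤ s ≤ m - 1`, a subset `I` with `|I| = s` such that `𝒫_I` has a weight of support
  exactly `I` (LR: "there exists a subset `ℍ_{i_1}, …, ℍ_{i_{m-1}}` with `ℓ(χ_{ℍ_{i_s}}) = s`");
* transitivity of `𝔖_m` on `s`-subsets and covariance of `𝒫_S` (`full_of_ne_empty`): EVERY
  non-empty `I ⊆ [m]` carries a weight of support `I` (LR: "`dim ℍ_{i_s} ≥ |𝔄_m · χ| = C(m,s)`");
* the count (`two_pow_sub_one_le_finrank`): `2^m - 2` distinct weights inside `range Λ` plus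
  `β_top`, so `n = dim V ≥ 2^m - 1`.

Hypotheses of the final statement: `dim ker Λ = 1` (regularity), some member of the pencil is
injective (`det Ã = perm_m ≠ 0`), and every row permutation has an exact lift.

## References

* J. M. Landsberg, N. Ressayre, *Permanent v. determinant: an exponential lower bound assuming
  symmetry and a potential path towards Valiant's conjecture*, Differential Geom. Appl. 55 (2017)
  146–166, arXiv:1508.05788, §6 (proof of Thm. 2.8, pp. 14–15).
-/

noncomputable section

namespace Literature.Computability.AlgebraicComplexity

namespace LRPencil

namespace TorusData

open Submodule Module.End Finset

variable {V : Type*} [AddCommGroup V] [Module ℂ V] {m : ℕ} (D : TorusData m V)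

/-! ### The top weight -/

section Top

variable [FiniteDimensional ℂ V]

omit [FiniteDimensional ℂ V] in
/-- If `B ≡ β_top` modulo a `B`-stable `H`, then `(B - β)^N ≡ (β_top - β)^N` modulo `H`. [folklore] -/
theorem pow_sub_apply_sub_mem {H : Submodule ℂ V} {βt : ℂ} (hβt : ∀ v, D.B v - βt • v ∈ H)
    (β : ℂ) (N : ℕ) (v : V) :
    ((D.B - β • (1 : Module.End ℂ V)) ^ N) v - (βt - β) ^ N • v ∈ H := by
  induction N with
  | zero => simp
  | succ N ih =>
    rw [pow_succ', Module.End.mul_apply, pow_succ', mul_smul]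
    set w := ((D.B - β • (1 : Module.End ℂ V)) ^ N) v
    have : (D.B - β • (1 : Module.End ℂ V)) w - (βt - β) • ((βt - β) ^ N • v) =
        (D.B w - βt • w) + (βt - β) • (w - (βt - β) ^ N • v) := by
      simp only [LinearMap.sub_apply, LinearMap.smul_apply, Module.End.one_apply]
      module
    rw [this]
    exact H.add_mem (hβt w) (H.smul_mem _ ih)

/-- **The top weight** (LR17 §6: `ℓ_2 = ℂⁿ / ℍ` is a line on which the lifted torus acts by a
character): if `ker Λ` is a line, then `range Λ` is a `B`-stable hyperplane and every weight
space `E β` with `β ≠ β_top` lies in `range Λ`. [cite: LandsbergRessayre2017, §6] -/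
theorem exists_top (hK : Module.finrank ℂ (LinearMap.ker D.Λ) = 1) :
    ∃ βt : ℂ, ∀ β, β ≠ βt → D.E β ≤ LinearMap.range D.Λ := by
  set H := LinearMap.range D.Λ with hHdef
  have hBH : H.map D.B ≤ H := (D.L.map_range_eq).le
  have hdim : Module.finrank ℂ H + 1 = Module.finrank ℂ V := by
    have := LinearMap.finrank_range_add_finrank_ker D.Λ
    rw [hK] at this; exact this
  have hHtop : H ≠ ⊤ := by
    intro h; rw [h, finrank_top] at hdim; omega
  obtain ⟨v₁, -, hv₁⟩ := SetLike.exists_of_lt (lt_top_iff_ne_top.2 hHtop)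
  have hsup : H ⊔ (ℂ ∙ v₁) = ⊤ := by
    apply Submodule.eq_top_of_finrank_eq
    apply le_antisymm (Submodule.finrank_le _)
    have hlt : H < H ⊔ (ℂ ∙ v₁) := by
      refine lt_of_le_of_ne le_sup_left fun h => hv₁ ?_
      rw [h]; exact Submodule.mem_sup_right (Submodule.mem_span_singleton_self v₁)
    have := Submodule.finrank_lt_finrank_of_lt hlt
    omega
  have hdec : ∀ v : V, ∃ h ∈ H, ∃ a : ℂ, v = h + a • v₁ := fun v => by
    have hv : v ∈ H ⊔ (ℂ ∙ v₁) := by rw [hsup]; exact Submodule.mem_top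
    obtain ⟨h, hh, z, hz, rfl⟩ := Submodule.mem_sup.1 hv
    obtain ⟨a, rfl⟩ := Submodule.mem_span_singleton.1 hz
    exact ⟨h, hh, a, rfl⟩
  obtain ⟨h₁, hh₁, βt, hB₁⟩ := hdec (D.B v₁)
  refine ⟨βt, fun β hβ => ?_⟩
  have hall : ∀ v, D.B v - βt • v ∈ H := fun v => by
    obtain ⟨h, hh, a, rfl⟩ := hdec v
    have : D.B (h + a • v₁) - βt • (h + a • v₁) = (D.B h - βt • h) + a • h₁ := by
      rw [map_add, map_smul, hB₁]; module
    rw [this]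
    exact H.add_mem (H.sub_mem (hBH (Submodule.mem_map_of_mem hh)) (H.smul_mem _ hh))
      (H.smul_mem _ hh₁)
  intro v hv
  obtain ⟨N, hN⟩ := (Module.End.mem_maxGenEigenspace _ _ _).1 hv
  have key := D.pow_sub_apply_sub_mem hall β N v
  rw [hN, zero_sub, neg_mem_iff] at key
  exact (Submodule.smul_mem_iff H (pow_ne_zero N (sub_ne_zero.2 (Ne.symm hβ)))).1 key

end Top

/-! ### Escape pins the top exponent; symmetry makes its support full -/

section Escape

variable [FiniteDimensional ℂ V]

/-- If `𝒫_S ⊄ range Λ` then some weight piece of `𝒫_S` is `⊄ range Λ`. [cite: LandsbergRessayre2017, §6] -/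
theorem exists_wt_of_not_le_range {S : Finset (Fin m)} (h : ¬ canon D.Λ D.A S ≤ LinearMap.range D.Λ) :
    ∃ u ∈ U S, ¬ canon D.Λ D.A S ⊓ D.E (D.wt u) ≤ LinearMap.range D.Λ := by
  by_contra hall
  push Not at hall
  exact h ((D.canon_le_iSup_inf S).trans (iSup_le fun u => hall u u.2))

omit [FiniteDimensional ℂ V] in
/-- A weight piece `⊄ range Λ` has the top weight. [cite: LandsbergRessayre2017, §6] -/
theorem wt_eq_of_not_le_range {βt : ℂ} (hβt : ∀ β, β ≠ βt → D.E β ≤ LinearMap.range D.Λ)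
    {P : Submodule ℂ V} {u : Fin m → ℕ} (h : ¬ P ⊓ D.E (D.wt u) ≤ LinearMap.range D.Λ) :
    D.wt u = βt := by
  by_contra hne
  exact h (inf_le_right.trans (hβt _ hne))

/-- Escape pins the exponent: if `𝒫_S ⊄ range Λ` and `wt u_top = β_top`, then `supp u_top ⊆ S`
and already `𝒫_{supp u_top} ⊄ range Λ`. [cite: LandsbergRessayre2017, §6] -/
theorem supp_subset_of_not_le_range {βt : ℂ} (hβt : ∀ β, β ≠ βt → D.E β ≤ LinearMap.range D.Λ)
    {ut : Fin m → ℕ} (hut : D.wt ut = βt) {S : Finset (Fin m)}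
    (h : ¬ canon D.Λ D.A S ≤ LinearMap.range D.Λ) :
    supp ut ⊆ S ∧ ¬ canon D.Λ D.A (supp ut) ≤ LinearMap.range D.Λ := by
  obtain ⟨u, hu, hne⟩ := D.exists_wt_of_not_le_range h
  have heq : u = ut := D.wt_injective ((D.wt_eq_of_not_le_range hβt hne).trans hut.symm)
  subst heq
  exact ⟨hu.2, fun hle => hne ((le_inf (D.canon_inf_wt_le_canon_supp hu) inf_le_right).trans
    (inf_le_left.trans hle))⟩

/-- **The top exponent has full support** (replaces LR17 §6: `χ_{ℓ_2}` is `𝔄_m`-invariant, hence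
`= α(ε_1 + ⋯ + ε_m)`): if `𝒫_{[m]} ⊄ range Λ`, `wt u_top = β_top`, `u_top ≠ 0`, and every
transposition of rows has an exact lift, then `supp u_top = [m]`. [cite: LandsbergRessayre2017, §6] -/
theorem supp_eq_univ_of_escape {βt : ℂ} (hβt : ∀ β, β ≠ βt → D.E β ≤ LinearMap.range D.Λ)
    {ut : Fin m → ℕ} (hut : D.wt ut = βt) (hut0 : ut ≠ 0)
    (hesc : ¬ canon D.Λ D.A univ ≤ LinearMap.range D.Λ)
    (hperm : ∀ σ : Equiv.Perm (Fin m), Nonempty (Lift D.Λ D.A σ fun _ => (1 : ℂ))) :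
    supp ut = univ := by
  set S₀ := supp ut with hS₀
  have hesc₀ : ¬ canon D.Λ D.A S₀ ≤ LinearMap.range D.Λ := (D.supp_subset_of_not_le_range hβt hut hesc).2
  by_contra hne
  obtain ⟨b, -, hb⟩ : ∃ b ∈ (univ : Finset (Fin m)), b ∉ S₀ :=
    exists_of_ssubset (ssubset_univ_iff.2 hne)
  have hS₀ne : S₀.Nonempty := by
    rw [nonempty_iff_ne_empty, Ne, supp_eq_empty_iff]; exact hut0
  obtain ⟨a, ha⟩ := hS₀ne
  set σ : Equiv.Perm (Fin m) := Equiv.swap a b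
  obtain ⟨L⟩ := hperm σ
  have hescσ : ¬ canon D.Λ D.A (S₀.map σ.toEmbedding) ≤ LinearMap.range D.Λ := by
    rwa [L.canon_le_range_iff]
  have hsub : S₀ ⊆ S₀.map σ.toEmbedding := (D.supp_subset_of_not_le_range hβt hut hescσ).1
  have ha' := hsub ha
  rw [mem_map_equiv, Equiv.symm_swap, Equiv.swap_apply_left] at ha'
  exact hb ha'

end Escape

/-! ### The chain: weights of every support size -/

section Chain

variable [FiniteDimensional ℂ V]

/-- `u` is GOOD if `0 ≠ u` and `wt u` is a weight of `𝒫_{[m]}`. [cite: LandsbergRessayre2017, §6] -/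
def Good (u : Fin m → ℕ) : Prop := u ∈ U univ ∧ canon D.Λ D.A univ ⊓ D.E (D.wt u) ≠ ⊥

/-- `S` is FULL if `𝒫_S` has a weight of support exactly `S`. [cite: LandsbergRessayre2017, §6] -/
def Full (S : Finset (Fin m)) : Prop :=
  ∃ u ∈ U S, supp u = S ∧ canon D.Λ D.A S ⊓ D.E (D.wt u) ≠ ⊥

/-- `supp e_k = {k}`. [folklore] -/
theorem supp_single (k : Fin m) : supp ((0 : Fin m → ℕ) + Pi.single k 1) = {k} := by
  rw [supp_add_single, (supp_eq_empty_iff 0).2 rfl]; rfl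

/-- `|u + e_k| = |u| + 1`. [folklore] -/
theorem sum_add_single (u : Fin m → ℕ) (k : Fin m) :
    ∑ i, (u + Pi.single k 1 : Fin m → ℕ) i = (∑ i, u i) + 1 := by
  simp [sum_add_distrib]

/-- One descent step preserves goodness: a good `u` with `|supp u| ≥ 2` comes from a good
`u' = u - e_k`. [cite: LandsbergRessayre2017, §6] -/
theorem exists_good_pred {u : Fin m → ℕ} (hu : D.Good u) (h2 : 2 ≤ (supp u).card) :
    ∃ k u', u = u' + Pi.single k 1 ∧ D.Good u' := by
  have hu1 : ∀ k, u ≠ 0 + Pi.single k 1 := by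
    intro k hk; rw [hk, supp_single, card_singleton] at h2; omega
  obtain ⟨k, -, u', hu', rfl, hne⟩ := D.exists_pred_of_canon_inf_wt_ne_bot hu1 hu.2
  exact ⟨k, u', rfl, hu', fun h => hne (by rw [h, bot_inf_eq])⟩

/-- **The chain** (LR17 §6: descending from `ℓ_2` through `ℍ_k, …, ℍ_1`, the lengths of the weights
take every value): from a good `u` one reaches good exponents of every support size
`1 ≤ s ≤ |supp u|`. [cite: LandsbergRessayre2017, §6] -/
theorem exists_good_of_le_card (n : ℕ) : ∀ u : Fin m → ℕ, ∑ i, u i = n → D.Good u →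
    ∀ s, 1 ≤ s → s ≤ (supp u).card → ∃ v, D.Good v ∧ (supp v).card = s := by
  induction n with
  | zero =>
    intro u hu _ s hs1 hs
    have : u = 0 := funext fun i => (sum_eq_zero_iff.1 hu) i (mem_univ i)
    rw [(supp_eq_empty_iff u).2 this, card_empty] at hs
    omega
  | succ n ih =>
    intro u hu hgood s hs1 hs
    by_cases hsc : s = (supp u).card
    · exact ⟨u, hgood, hsc.symm⟩
    · have h2 : 2 ≤ (supp u).card := by omega
      obtain ⟨k, u', rfl, hgood'⟩ := D.exists_good_pred hgood h2
      refine ih u' ?_ hgood' s hs1 ?_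
      · rw [sum_add_single] at hu; omega
      · rw [supp_add_single] at hs
        have := card_insert_le k (supp u')
        rw [supp_add_single] at hsc
        omega

/-- A good exponent makes its support full. [cite: LandsbergRessayre2017, §6] -/
theorem full_supp_of_good {v : Fin m → ℕ} (hv : D.Good v) : D.Full (supp v) :=
  ⟨v, ⟨hv.1.1, subset_rfl⟩, rfl, fun h => hv.2 (by
    rw [eq_bot_iff, ← h]; exact D.canon_inf_wt_le hv.1 subset_rfl)⟩

/-- FULL implies CANONICALLY NEW: `𝒫_S ⊄ Σ_{S' ⊊ S} 𝒫_{S'}` (the weight of support `S` cannot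
come from smaller supports). [cite: LandsbergRessayre2017, §6] -/
theorem not_le_iSup_of_full {S : Finset (Fin m)} (hS : D.Full S) :
    ¬ canon D.Λ D.A S ≤ ⨆ (S' : Finset (Fin m)) (_ : S' ⊂ S), canon D.Λ D.A S' := by
  obtain ⟨u, hu, hsupp, hne⟩ := hS
  intro hle
  apply hne
  -- all weights below come from exponents with support `⊂ S`
  let ι := {q : Finset (Fin m) × (Fin m → ℕ) // q.1 ⊂ S ∧ q.2 ∈ U q.1}
  have hgrid : (⨆ (S' : Finset (Fin m)) (_ : S' ⊂ S), canon D.Λ D.A S') ≤ ⨆ q : ι, D.E (D.wt q.1.2) :=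
    iSup₂_le fun S' hS' => (D.canon_le_grid S').trans
      (iSup_le fun u' => le_iSup (fun q : ι => D.E (D.wt q.1.2)) ⟨(S', u'.1), hS', u'.2⟩)
  have hw : ∀ q : ι, D.wt q.1.2 ≠ D.wt u := fun q h => by
    have h' := D.wt_injective h
    have : supp u ⊂ S := by
      rw [← h']; exact lt_of_le_of_lt (α := Finset (Fin m)) q.2.2.2 q.2.1
    rw [hsupp] at this
    exact lt_irrefl _ this
  rw [eq_bot_iff]
  calc canon D.Λ D.A S ⊓ D.E (D.wt u) ≤ (⨆ q : ι, D.E (D.wt q.1.2)) ⊓ D.E (D.wt u) :=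
        inf_le_inf_right _ (hle.trans hgrid)
    _ = ⊥ := iSup_maxGen_inf_eq_bot _ _ hw

/-- CANONICALLY NEW implies FULL: if `𝒫_S ⊄ Σ_{S' ⊊ S} 𝒫_{S'}` then `𝒫_S` has a weight of
support exactly `S`. [cite: LandsbergRessayre2017, §6] -/
theorem full_of_not_le_iSup {S : Finset (Fin m)}
    (hS : ¬ canon D.Λ D.A S ≤ ⨆ (S' : Finset (Fin m)) (_ : S' ⊂ S), canon D.Λ D.A S') :
    D.Full S := by
  by_contra hfull
  simp only [Full, not_exists, not_and, not_not] at hfull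
  apply hS
  refine (D.canon_le_iSup_inf S).trans (iSup_le fun u => ?_)
  by_cases hsu : supp u.1 = S
  · rw [hfull u u.2 hsu]; exact bot_le
  · have hss : supp u.1 ⊂ S := Finset.ssubset_iff_subset_ne.2 ⟨u.2.2, hsu⟩
    exact (D.canon_inf_wt_le_canon_supp u.2).trans (le_biSup (fun S' => canon D.Λ D.A S') hss)

omit [FiniteDimensional ℂ V] in
/-- Covariance: CANONICALLY NEW is transported by the lift of a permutation. [cite: LandsbergRessayre2017, §6] -/
theorem not_le_iSup_map {S : Finset (Fin m)} (σ : Equiv.Perm (Fin m))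
    (L : Lift D.Λ D.A σ⁻¹ fun _ => (1 : ℂ))
    (hS : ¬ canon D.Λ D.A S ≤ ⨆ (S' : Finset (Fin m)) (_ : S' ⊂ S), canon D.Λ D.A S') :
    ¬ canon D.Λ D.A (S.map σ.toEmbedding) ≤
      ⨆ (S' : Finset (Fin m)) (_ : S' ⊂ S.map σ.toEmbedding), canon D.Λ D.A S' := by
  intro h
  have h' := L.canon_le_iSup_ssubsets_transfer h
  have hSS : (S.map σ.toEmbedding).map σ⁻¹.toEmbedding = S := by
    ext x
    simp only [mem_map_equiv, Equiv.Perm.inv_def, Equiv.symm_symm, Equiv.symm_apply_apply]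
  rw [hSS] at h'
  exact hS h'

/-- **Every non-empty subset is full** (LR17 §6: the lengths `1, …, m-1` all occur and
`𝔄_m` — here `𝔖_m` — is transitive on `s`-subsets). [cite: LandsbergRessayre2017, §6] -/
theorem full_of_ne_empty {ut : Fin m → ℕ} (hgood : D.Good ut) (hsupp : supp ut = univ)
    (hperm : ∀ σ : Equiv.Perm (Fin m), Nonempty (Lift D.Λ D.A σ fun _ => (1 : ℂ)))
    {S : Finset (Fin m)} (hS1 : S ≠ ∅) : D.Full S := by
  have hs1 : 1 ≤ S.card := by
    rw [Nat.one_le_iff_ne_zero]; exact fun h => hS1 (card_eq_zero.1 h)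
  have hsm : S.card ≤ (supp ut).card := by
    rw [hsupp]; exact card_le_univ S
  obtain ⟨v, hv, hcard⟩ := D.exists_good_of_le_card _ ut rfl hgood S.card hs1 hsm
  have hfull := D.full_supp_of_good hv
  obtain ⟨σ, hσ⟩ := Equiv.Perm.exists_map_finset_eq (supp v) S hcard
  obtain ⟨L⟩ := hperm σ⁻¹
  have := D.not_le_iSup_map σ L (D.not_le_iSup_of_full hfull)
  rw [hσ] at this
  exact D.full_of_not_le_iSup this

end Chain

/-! ### The count -/

section Count

variable [FiniteDimensional ℂ V]

/-- **LR17 Thm. 2.8, abstract form.**  For a torus datum with `dim ker Λ = 1` (regularity), an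
injective member of the pencil (`det Ã ≠ 0`) and exact lifts of all row permutations,
`dim V ≥ 2^m - 1`: the `2^m - 2` weights `wt u_S` (one of support `S` for each proper non-empty
`S`) and the top weight are pairwise distinct and all occur. [cite: LandsbergRessayre2017, Thm. 2.8] -/
theorem two_pow_sub_one_le_finrank (hm : 1 ≤ m) (hK : Module.finrank ℂ (LinearMap.ker D.Λ) = 1)
    (hgen : ∃ x : Fin m → Fin m → ℂ, Function.Injective (D.Λ + ∑ k, ∑ j, x k j • D.A k j))
    (hperm : ∀ σ : Equiv.Perm (Fin m), Nonempty (Lift D.Λ D.A σ fun _ => (1 : ℂ))) :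
    2 ^ m - 1 ≤ Module.finrank ℂ V := by
  classical
  have hK0 : LinearMap.ker D.Λ ≠ ⊥ := by
    intro h; rw [h, finrank_bot] at hK; exact zero_ne_one hK
  have hesc := not_canon_univ_le_range (A := D.A) hK0 hgen
  obtain ⟨βt, hβt⟩ := D.exists_top hK
  obtain ⟨ut, hut, hutne⟩ := D.exists_wt_of_not_le_range hesc
  have hwt : D.wt ut = βt := D.wt_eq_of_not_le_range hβt hutne
  have hgood : D.Good ut := ⟨hut, fun h => hutne (by rw [h]; exact bot_le)⟩
  have hsupp : supp ut = univ := D.supp_eq_univ_of_escape hβt hwt hut.1 hesc hperm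
  -- one exponent of support `S` for each proper non-empty `S`
  let 𝒮 := {S : Finset (Fin m) // S ≠ ∅ ∧ S ≠ univ}
  have hfull : ∀ S : 𝒮, D.Full S.1 := fun S => D.full_of_ne_empty hgood hsupp hperm S.2.1
  choose uS huS hsuppS hneS using hfull
  -- the family of weight spaces
  let g : 𝒮 ⊕ Unit → ℂ := fun i => match i with
    | Sum.inl S => D.wt (uS S)
    | Sum.inr _ => D.wt ut
  have hg : Function.Injective g := by
    rintro (S | _) (S' | _) h
    · have h1 : uS S = uS S' := D.wt_injective h
      have : S.1 = S'.1 := by rw [← hsuppS S, ← hsuppS S', h1]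
      rw [Subtype.ext this]
    · have h1 : uS S = ut := D.wt_injective h
      exact (S.2.2 (by rw [← hsuppS S, h1, hsupp])).elim
    · have h1 : ut = uS S' := D.wt_injective h
      exact (S'.2.2 (by rw [← hsuppS S', ← h1, hsupp])).elim
    · rfl
  have hind : iSupIndep (D.E ∘ g) := D.B.independent_maxGenEigenspace.comp hg
  have hne : ∀ i, (D.E ∘ g) i ≠ ⊥ := by
    rintro (S | _)
    · exact fun h => hneS S (by rw [eq_bot_iff, ← h]; exact inf_le_right)
    · exact fun h => hgood.2 (by rw [eq_bot_iff, ← h]; exact inf_le_right)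
  have hcard := hind.subtype_ne_bot_le_finrank
  rw [Fintype.card_congr (Equiv.subtypeUnivEquiv hne), Fintype.card_sum, Fintype.card_unit,
    Fintype.card_subtype] at hcard
  have h𝒮 : (univ.filter fun S : Finset (Fin m) => S ≠ ∅ ∧ S ≠ univ).card = 2 ^ m - 2 :=
    LR28.card_filter_proper_nonempty hm
  rw [h𝒮] at hcard
  have h2m : 2 ≤ 2 ^ m := by
    calc 2 = 2 ^ 1 := by norm_num
      _ ≤ 2 ^ m := Nat.pow_le_pow_right (by norm_num) hm
  omega

end Count

end TorusData

end LRPencil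

end Literature.Computability.AlgebraicComplexity
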